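import Summits.Ventures.PercRepro.RankLevelSetLevelEightArithPartThreeA
import Summits.Ventures.PercRepro.RankLevelSetLevelEightArithPartThreeB
import Summits.Ventures.PercRepro.RankLevelSetLevelEightArithPartThreeC
import Summits.Ventures.PercRepro.RankLevelSetLevelEightArithPartThreeD
import Summits.Ventures.PercRepro.RankLevelSetLevelEightArithPartThreeE
import Summits.Ventures.PercRepro.RankLevelSetLevelEightArithPartThreeF
import Summits.Ventures.PercRepro.RankLevelSetLevelEightArithPartThreeG
import Summits.Ventures.PercRepro.RankLevelSetLevelEightArithPartThreeH
import Summits.Ventures.PercRepro.RankLevelSetLevelEightArithPartThreeI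
import Summits.Ventures.PercRepro.RankLevelSetLevelEightArithPartThreeJ
import Summits.Ventures.PercRepro.RankLevelSetLevelEightArithPartThreeK
import Summits.Ventures.PercRepro.RankLevelSetLevelEightArithPartThreeL
import Summits.Ventures.PercRepro.RankLevelSetLevelEightArithPartThreeM
import Summits.Ventures.PercRepro.RankLevelSetLevelEightArithPartThreeN
import Summits.Ventures.PercRepro.RankLevelSetLevelEightArithPartThreeO
import Summits.Ventures.PercRepro.RankLevelSetLevelEightArithPartThreeP

/-!
# PercRepro — THE LEVEL-`8` DISPATCHER OF THE PARTITION CHAIN WITH THE THREE-MULTIPLICITY: `(P_d)` for `9 ≤ d ≤ 184`, `p ≥ 327`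
(p4, gen 15; a feeder for S4). The 176 cases of RankLevelSetLevelEightArithPartThreeA … P in one statement generic in `d`.
Axioms: standard.
-/

namespace PercRepro

namespace ThmN

/-- **`(P_d)` at level `8` in the `7/8` form with the three-multiplicity (partition count), every corank `9 ≤ d ≤ 184`,
every `p ≥ 327`, in `ℚ`** — the dispatcher of the 176 cases. -/
theorem level_eight_poly_part3 (d : ℕ) (hd1 : 9 ≤ d) (hd2 : d ≤ 184) (p : ℕ) (hp : 327 ≤ p) :
    8 * ((((p + d).choose 8 : ℕ) : ℚ) + (∑ j ∈ Finset.range (d - 8), ((Nat.choose (min 150 (max ((d + min 72 d) / 2 + 1) (min 71 (d - 1) + 2) - 2)) j : ℕ) : ℚ) / (((j + 1) + 3 * (j + 1).choose 2 : ℕ) : ℚ)) *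
      (((d * (d + 1) / 2 : ℕ) : ℚ) * ((p + d).choose 6 : ℚ) + ((d * (d + 1) * (d + 2) / 3 : ℕ) : ℚ) * ((p + d).choose 5 : ℚ) + (((d + 4).choose 5 : ℕ) : ℚ) * ((p + d).choose 4 : ℚ) + (((d + 5).choose 6 : ℕ) : ℚ) * ((p + d).choose 3 : ℚ) + (((d + 6).choose 7 : ℕ) : ℚ) * ((p + d).choose 2 : ℚ) + (((d + 7).choose 8 : ℕ) : ℚ) * (p + d : ℚ) + (((d + 8).choose 9 : ℕ) : ℚ)) +
      ((∑ j ∈ Finset.range (d - 8), ((Nat.choose (min 159 (8 + d) - 9) j : ℕ) : ℚ) / (((j + 1) + 3 * (j + 1).choose 2 : ℕ) : ℚ)) - (∑ j ∈ Finset.range (d - 8), ((Nat.choose (min 71 (d - 1)) j : ℕ) : ℚ) / (((j + 1) + 3 * (j + 1).choose 2 : ℕ) : ℚ))) *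
      ((d * (d + 1) / 2 * (min 159 (8 + d)).choose 6 + d * (d + 1) * (d + 2) / 3 * (min 159 (8 + d)).choose 5 + (d + 4).choose 5 * (min 159 (8 + d)).choose 4 + (d + 5).choose 6 * (min 159 (8 + d)).choose 3 + (d + 6).choose 7 * (min 159 (8 + d)).choose 2 + (d + 7).choose 8 * (min 159 (8 + d)) + (d + 8).choose 9 : ℕ) : ℚ)) ≤
      7 * 2 ^ (d - 8) * (((p + 8).choose 8 : ℕ) : ℚ) := by
  interval_cases d
  · exact level_eight_poly_part3_9 p hp
  · exact level_eight_poly_part3_10 p hp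
  · exact level_eight_poly_part3_11 p hp
  · exact level_eight_poly_part3_12 p hp
  · exact level_eight_poly_part3_13 p hp
  · exact level_eight_poly_part3_14 p hp
  · exact level_eight_poly_part3_15 p hp
  · exact level_eight_poly_part3_16 p hp
  · exact level_eight_poly_part3_17 p hp
  · exact level_eight_poly_part3_18 p hp
  · exact level_eight_poly_part3_19 p hp
  · exact level_eight_poly_part3_20 p hp
  · exact level_eight_poly_part3_21 p hp
  · exact level_eight_poly_part3_22 p hp
  · exact level_eight_poly_part3_23 p hp
  · exact level_eight_poly_part3_24 p hp
  · exact level_eight_poly_part3_25 p hp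
  · exact level_eight_poly_part3_26 p hp
  · exact level_eight_poly_part3_27 p hp
  · exact level_eight_poly_part3_28 p hp
  · exact level_eight_poly_part3_29 p hp
  · exact level_eight_poly_part3_30 p hp
  · exact level_eight_poly_part3_31 p hp
  · exact level_eight_poly_part3_32 p hp
  · exact level_eight_poly_part3_33 p hp
  · exact level_eight_poly_part3_34 p hp
  · exact level_eight_poly_part3_35 p hp
  · exact level_eight_poly_part3_36 p hp
  · exact level_eight_poly_part3_37 p hp
  · exact level_eight_poly_part3_38 p hp
  · exact level_eight_poly_part3_39 p hp
  · exact level_eight_poly_part3_40 p hp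
  · exact level_eight_poly_part3_41 p hp
  · exact level_eight_poly_part3_42 p hp
  · exact level_eight_poly_part3_43 p hp
  · exact level_eight_poly_part3_44 p hp
  · exact level_eight_poly_part3_45 p hp
  · exact level_eight_poly_part3_46 p hp
  · exact level_eight_poly_part3_47 p hp
  · exact level_eight_poly_part3_48 p hp
  · exact level_eight_poly_part3_49 p hp
  · exact level_eight_poly_part3_50 p hp
  · exact level_eight_poly_part3_51 p hp
  · exact level_eight_poly_part3_52 p hp
  · exact level_eight_poly_part3_53 p hp
  · exact level_eight_poly_part3_54 p hp
  · exact level_eight_poly_part3_55 p hp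
  · exact level_eight_poly_part3_56 p hp
  · exact level_eight_poly_part3_57 p hp
  · exact level_eight_poly_part3_58 p hp
  · exact level_eight_poly_part3_59 p hp
  · exact level_eight_poly_part3_60 p hp
  · exact level_eight_poly_part3_61 p hp
  · exact level_eight_poly_part3_62 p hp
  · exact level_eight_poly_part3_63 p hp
  · exact level_eight_poly_part3_64 p hp
  · exact level_eight_poly_part3_65 p hp
  · exact level_eight_poly_part3_66 p hp
  · exact level_eight_poly_part3_67 p hp
  · exact level_eight_poly_part3_68 p hp
  · exact level_eight_poly_part3_69 p hp
  · exact level_eight_poly_part3_70 p hp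
  · exact level_eight_poly_part3_71 p hp
  · exact level_eight_poly_part3_72 p hp
  · exact level_eight_poly_part3_73 p hp
  · exact level_eight_poly_part3_74 p hp
  · exact level_eight_poly_part3_75 p hp
  · exact level_eight_poly_part3_76 p hp
  · exact level_eight_poly_part3_77 p hp
  · exact level_eight_poly_part3_78 p hp
  · exact level_eight_poly_part3_79 p hp
  · exact level_eight_poly_part3_80 p hp
  · exact level_eight_poly_part3_81 p hp
  · exact level_eight_poly_part3_82 p hp
  · exact level_eight_poly_part3_83 p hp
  · exact level_eight_poly_part3_84 p hp
  · exact level_eight_poly_part3_85 p hp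
  · exact level_eight_poly_part3_86 p hp
  · exact level_eight_poly_part3_87 p hp
  · exact level_eight_poly_part3_88 p hp
  · exact level_eight_poly_part3_89 p hp
  · exact level_eight_poly_part3_90 p hp
  · exact level_eight_poly_part3_91 p hp
  · exact level_eight_poly_part3_92 p hp
  · exact level_eight_poly_part3_93 p hp
  · exact level_eight_poly_part3_94 p hp
  · exact level_eight_poly_part3_95 p hp
  · exact level_eight_poly_part3_96 p hp
  · exact level_eight_poly_part3_97 p hp
  · exact level_eight_poly_part3_98 p hp
  · exact level_eight_poly_part3_99 p hp
  · exact level_eight_poly_part3_100 p hp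
  · exact level_eight_poly_part3_101 p hp
  · exact level_eight_poly_part3_102 p hp
  · exact level_eight_poly_part3_103 p hp
  · exact level_eight_poly_part3_104 p hp
  · exact level_eight_poly_part3_105 p hp
  · exact level_eight_poly_part3_106 p hp
  · exact level_eight_poly_part3_107 p hp
  · exact level_eight_poly_part3_108 p hp
  · exact level_eight_poly_part3_109 p hp
  · exact level_eight_poly_part3_110 p hp
  · exact level_eight_poly_part3_111 p hp
  · exact level_eight_poly_part3_112 p hp
  · exact level_eight_poly_part3_113 p hp
  · exact level_eight_poly_part3_114 p hp
  · exact level_eight_poly_part3_115 p hp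
  · exact level_eight_poly_part3_116 p hp
  · exact level_eight_poly_part3_117 p hp
  · exact level_eight_poly_part3_118 p hp
  · exact level_eight_poly_part3_119 p hp
  · exact level_eight_poly_part3_120 p hp
  · exact level_eight_poly_part3_121 p hp
  · exact level_eight_poly_part3_122 p hp
  · exact level_eight_poly_part3_123 p hp
  · exact level_eight_poly_part3_124 p hp
  · exact level_eight_poly_part3_125 p hp
  · exact level_eight_poly_part3_126 p hp
  · exact level_eight_poly_part3_127 p hp
  · exact level_eight_poly_part3_128 p hp
  · exact level_eight_poly_part3_129 p hp
  · exact level_eight_poly_part3_130 p hp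
  · exact level_eight_poly_part3_131 p hp
  · exact level_eight_poly_part3_132 p hp
  · exact level_eight_poly_part3_133 p hp
  · exact level_eight_poly_part3_134 p hp
  · exact level_eight_poly_part3_135 p hp
  · exact level_eight_poly_part3_136 p hp
  · exact level_eight_poly_part3_137 p hp
  · exact level_eight_poly_part3_138 p hp
  · exact level_eight_poly_part3_139 p hp
  · exact level_eight_poly_part3_140 p hp
  · exact level_eight_poly_part3_141 p hp
  · exact level_eight_poly_part3_142 p hp
  · exact level_eight_poly_part3_143 p hp
  · exact level_eight_poly_part3_144 p hp
  · exact level_eight_poly_part3_145 p hp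
  · exact level_eight_poly_part3_146 p hp
  · exact level_eight_poly_part3_147 p hp
  · exact level_eight_poly_part3_148 p hp
  · exact level_eight_poly_part3_149 p hp
  · exact level_eight_poly_part3_150 p hp
  · exact level_eight_poly_part3_151 p hp
  · exact level_eight_poly_part3_152 p hp
  · exact level_eight_poly_part3_153 p hp
  · exact level_eight_poly_part3_154 p hp
  · exact level_eight_poly_part3_155 p hp
  · exact level_eight_poly_part3_156 p hp
  · exact level_eight_poly_part3_157 p hp
  · exact level_eight_poly_part3_158 p hp
  · exact level_eight_poly_part3_159 p hp
  · exact level_eight_poly_part3_160 p hp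
  · exact level_eight_poly_part3_161 p hp
  · exact level_eight_poly_part3_162 p hp
  · exact level_eight_poly_part3_163 p hp
  · exact level_eight_poly_part3_164 p hp
  · exact level_eight_poly_part3_165 p hp
  · exact level_eight_poly_part3_166 p hp
  · exact level_eight_poly_part3_167 p hp
  · exact level_eight_poly_part3_168 p hp
  · exact level_eight_poly_part3_169 p hp
  · exact level_eight_poly_part3_170 p hp
  · exact level_eight_poly_part3_171 p hp
  · exact level_eight_poly_part3_172 p hp
  · exact level_eight_poly_part3_173 p hp
  · exact level_eight_poly_part3_174 p hp
  · exact level_eight_poly_part3_175 p hp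
  · exact level_eight_poly_part3_176 p hp
  · exact level_eight_poly_part3_177 p hp
  · exact level_eight_poly_part3_178 p hp
  · exact level_eight_poly_part3_179 p hp
  · exact level_eight_poly_part3_180 p hp
  · exact level_eight_poly_part3_181 p hp
  · exact level_eight_poly_part3_182 p hp
  · exact level_eight_poly_part3_183 p hp
  · exact level_eight_poly_part3_184 p hp

end ThmN

end PercRepro
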